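import Summits.BirchSwinnertonDyer.BirchSwinnertonDyer.Theorems.GenusKolyvaginAtTwoMinimalTwinBSDTwoAnalyticTwin
import HarnessLib

/-!
# Rung K4 leaf `NonCMAtTwo` through route `GenusKolyvaginAtTwo` (crux U₂ `MinimalTwinBSDTwo`, stmt-BirchSwinnertonDyer-22985, LINE 23 «twin_swap»):
# THE RANK-ONE TRANSFER IN INDEX CURRENCY — BSD₂ for EVERY non-CM curve of analytic rank 1 ⟸ the rank-zero wall + Friedberg–Hoffstein + PRINT +
# ONE research statement IDX (the 2-primary Gross–Zagier index relation `#Ш(W_K)[2^∞] · 4^{ord₂ c + ord₂ C(W)} = 4^{ord₂ [W(K) : ℤ P_K]}`), LOSSLESS;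
# hence, modulo PRINT + FH: **`NonCMAtTwo ⟺ (rank-zero wall) ∧ IDX`**

Seat `bsd-line-gk2-p2` g27 (PROVER seat 2/3, cell `bsd-f1-sign2`, LINE 23 holder), `--supports stmt-BirchSwinnertonDyer-22985` (helper; closes
nothing).  THEOREMS ONLY; standard axioms.  **BSD is NOT proved by this file; the leaf, U₂, the wall and IDX are NOT proved; no item is closed.**
CONDITIONAL on the displayed hypotheses; PRINT = the route's statement-only named facts (`gross_zagier`, `rank_eq_analyticRank_of_analyticRank_le_one`,
`hasEntireLFunction_rat`, `Milne1972.bsdQuotient_baseChange_quadratic_anyModel`, `nonempty_modularParametrizationData`) + Friedberg–Hoffstein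
(`friedbergHoffstein_exists_heegnerField_split_twist_ne_zero`, Literature, statement-only).

THE POINT (census currency of LEAD gk2-p1 g27, p783309: the leaf ⟺ WALL row 1 ∧ `OffHabitatResidualAtTwo`; the route's non-dominated content =
rank-0 → rank-1 TRANSFER theorems).  This seat's v2.4 (`AnalyticTwin`, p786103) transfers the U₂ class (`r_an = 1`, `#Sel₂ = 2`) from the wall along an
ANALYTIC twin (Friedberg–Hoffstein) at the price of the exactness relation KEX′ in `2`-divisibility-depth currency — which needs `W(K[1])[2] = 0`, i.e.
`#Sel₂(W) = 2`.  In INDEX currency the same bookkeeping needs NO Selmer hypothesis on `W` at all: Gross–Zagier over `K` in the tree's exact form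
`CMExactDescent.shaAnOverC_baseChange_eq_of_heegner` reads `#Ш_an(W_K) = 4 I² / (c² w_K² C(W)²)` with `I = [W(K) : ℤ P_K]` (torsion INSIDE the index),
for ANY `W` with `r_an(W_K) = 1`.  Hence, for EVERY non-CM globally minimal `W` with `r_an(W) = 1` (any `Sel₂(W)`, any torsion, any sign, any `C(W)`):
* §1 `missingPPartOverCAt_baseChange_of_idx` — at a frame (`K` imaginary quadratic, `d_K < −4`, Heegner, `L(W^{(d_K)},1) ≠ 0`; datum `Dt`; Heegner point
  `P ∈ W(K)`), the relation **IDX** `#Ш(W_K)[2^∞] · 4^{ord₂ c + ord₂ C(W)} = 4^{ord₂ I}` gives `MissingPPartOverCAt (W ⊗ K) 2`;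
* §2 ★ `bsdp_rankOne_of_wall_of_friedbergHoffstein_of_idx_of_facts` — **BSD₂ for EVERY non-CM globally minimal `W` with `r_an = 1` ⟸ S1′ (BSD₂ for non-CM
  rank-`0` curves = WALL row 1) + FH + IDX + PRINT** (parity ⟹ `w(W) = −1`; FH ⟹ analytic twin field with `2` split, `|d_K| > 4`; Néron minimal model of
  the twist, non-CM of analytic rank `0`, `BSD₂` by S1′; datum (BCDT) and Heegner point over `K` (Gross §4 / Shimura reciprocity, tree); IDX; §1; Milne);
* §3 ★ `idx_of_bsdp_rankLeOne_of_facts` — **LOSSLESS**: BSD₂ for non-CM `r_an ≤ 1` curves + PRINT ⟹ IDX (on every frame, FH not needed);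
* §4 ★ `nonCMAtTwo_iff_rankZero_and_idx_of_facts` — modulo PRINT + FH: **`Rank1Residual.NonCMAtTwo ↔ S1′ ∧ IDX`**: the K4 leaf is the rank-zero wall
  plus ONE ∀-statement, Gross's conjecture (GZ V (2.2) ⊗ BSD) at `p = 2` for non-CM rank-one curves over Friedberg–Hoffstein fields.
Nothing here is progress on BSD: IDX is exactly as open as the rank-one half of the leaf.

References: [GrossZagier1986] I.(6.3), V.§2 (2.1)–(2.2); [GrossLMS1991] §1 (1.2), §2 Conj. (2.2); [FriedbergHoffstein1995] main theorem;
[BurungaleSkinnerTianWan2024] proof of Thm. 12.3; [Milne1972ArithmeticAV] §1 Thm. 1; [BCDTJAMS2001] Thm. A; [SilvermanAEC2009] VIII.8 Cor. 8.3, C.16;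
[Kolyvagin1989Izv] Thm. A; [Miller2011LMS] Def. 1.1.
-/

set_option autoImplicit false
set_option linter.dupNamespace false -- `Summit.<P>.<Sub>` repeats `BirchSwinnertonDyer` (D-0017)

noncomputable section

open scoped Classical

open WeierstrassCurve NumberField Literature.NumberTheory.EllipticCurves
  Literature.NumberTheory.EllipticCurves.ModularForms
  Literature.NumberTheory.EllipticCurves.Rank1Residual
  Literature.NumberTheory.EllipticCurves.Rank1Residual.Typed
  Literature.NumberTheory.EllipticCurves.KrizLi2019
  Summit.BirchSwinnertonDyer.Rank1Residual
  Summit.BirchSwinnertonDyer.Rank1Residual.AdditivePotMult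
  Summit.BirchSwinnertonDyer.BirchSwinnertonDyer.Rank1Residual
  Summit.BirchSwinnertonDyer.BirchSwinnertonDyer.Theorems.CMExactDescent
  Summit.BirchSwinnertonDyer.BirchSwinnertonDyer.Theorems.GenusExact.TwinSwap
  Summit.BirchSwinnertonDyer.BirchSwinnertonDyer.Theorems.GenusExact.TwinSwap.IdentityDoor

open Summit.BirchSwinnertonDyer.BirchSwinnertonDyer.Theorems.GenusExact.TwinSwap.Ledger.Line25
  (exists_kolyvaginHeegnerData_one_of_nonempty_modularParametrizationData)
open Literature.NumberTheory.QuadraticFields.Quadratic (ncard_primesOver_two_eq_two_iff)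

namespace Summit.BirchSwinnertonDyer.BirchSwinnertonDyer.Theorems.GenusExact.TwinSwap.RankOneTransfer

/-! ## §1 The index relation gives the 2-part over `K` -/

/-- **IDX ⟹ `MissingPPartOverCAt (W ⊗ K) 2`, for ANY rank-one `W`.**  `W/ℚ` globally minimal with `r_an(W) = 1` (no Selmer, torsion or sign hypothesis);
`K` imaginary quadratic with `d_K < −4`, Heegner for `N_W`, `L(W^{(d_K)},1) ≠ 0`; a datum `Dt`, a Heegner datum `H`, and `P ∈ W(K)` mapping to the
complex Heegner point; PRINT `hGZ` (for `(N_W, W, K)`), `hGZK`, `hmod`.  If `#Ш(W_K)[2^∞] · 2^{2(ord₂ c + ord₂ C(W))} = 2^{2 ord₂ [W(K) : ℤP]}` then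
`ord₂ #Ш_an(W_K) = ord₂ #Ш(W_K)`; also `Ш(W_K)` is finite and `P` has infinite order.  Proof: `r_an(W^{(d_K)}) = 0`, so `r_an(W_K) = 1`; the tree's exact
Gross–Zagier identity `#Ш_an(W_K) = 4I²/(c² w_K² C(W)²)` (`shaAnOverC_baseChange_eq_of_heegner`) with `w_K = 2`; valuations.
[cite: GrossZagier1986, Thm. I.6.3, V.(2.1)–(2.2)] [cite: GrossLMS1991, §2 Conj. (2.2)] -/
theorem missingPPartOverCAt_baseChange_of_idx
    (W : WeierstrassCurve ℚ) [W.IsElliptic] [W.IsGloballyMinimal] [NeZero (W.conductorNorm ℤ)]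
    (K : Type) [Field K] [NumberField K]
    (hGZ : gross_zagier (W.conductorNorm ℤ) W K) (hGZK : rank_eq_analyticRank_of_analyticRank_le_one) (hmod : hasEntireLFunction_rat)
    (hr : W.analyticRank = 1) (hK : IsImaginaryQuadratic K) (hlt : NumberField.discr K < -4)
    (hH : SatisfiesHeegnerHypothesis (W.conductorNorm ℤ) K)
    (hL : (W.quadraticTwist (NumberField.discr K : ℚ)).entireLFunction 1 ≠ 0)
    (Dt : ModularParametrizationData W (W.conductorNorm ℤ)) (H : HeegnerDatum (W.conductorNorm ℤ) (NumberField.discr K))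
    (ι : K →+* ℂ) (P : (W.baseChange K).toAffine.Point)
    (hP : WeierstrassCurve.Affine.Point.map ι.toRatAlgHom P = heegnerPointComplex Dt H)
    (hidx : Nat.card (AddCommGroup.primaryComponent (W.baseChange K).sha 2) *
        2 ^ (2 * (padicValInt 2 Dt.c + padicValNat 2 W.tamagawaProduct)) =
      2 ^ (2 * padicValNat 2 (AddSubgroup.zmultiples P).index)) :
    MissingPPartOverCAt (W.baseChange K) 2 ∧ Finite (W.baseChange K).sha ∧ ¬ IsOfFinAddOrder P := by
  haveI : Fact (Nat.Prime 2) := ⟨Nat.prime_two⟩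
  haveI hEK : (W.baseChange K).IsElliptic := isElliptic_baseChange' W K
  have h2 : Module.finrank ℚ K = 2 := hK.1
  have hD0 : (NumberField.discr K : ℚ) ≠ 0 := by exact_mod_cast NumberField.discr_ne_zero K
  haveI hEt : (W.quadraticTwist (NumberField.discr K : ℚ)).IsElliptic := W.isElliptic_quadraticTwist hD0
  have hw2 : Units.torsionOrder K = 2 :=
    Literature.NumberTheory.QuadraticFields.Quadratic.torsionOrder_eq_two_of_discr_lt_neg_four h2 hlt
  have hc0 : Dt.c ≠ 0 := fun h ↦ Dt.cast_c_ne_zero (by rw [h, Int.cast_zero])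
  -- analytic ranks: `r_an(W^{(d_K)}) = 0`, so `r_an(W_K) = 1`
  have hrt : (W.quadraticTwist (NumberField.discr K : ℚ)).analyticRank = 0 :=
    ((W.quadraticTwist (NumberField.discr K : ℚ)).analyticRank_eq_zero_iff_holds (hmod _)).mpr hL
  have hrK : (W.baseChange K).analyticRank = 1 :=
    (P2.analyticRank_baseChange_eq_one_iff W K hmod h2).mpr (Or.inl ⟨hr, hrt⟩)
  -- Gross–Zagier over `K`, exact form
  obtain ⟨hrkK, hShaK, hPinf, hshaC⟩ := shaAnOverC_baseChange_eq_of_heegner W K Dt H ι P hGZ hGZK hmod hK hH hP hc0 hrK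
  haveI hfinK : Finite (W.baseChange K).sha := hShaK
  set I := (AddSubgroup.zmultiples P).index with hI_def
  have hI0 : I ≠ 0 := fun hI ↦ by
    have hh := P2.torsionOrder_sq_mul_canonicalHeight_eq_index_sq_mul_regulator (W.baseChange K) hrkK P hPinf
    rw [← hI_def, hI, Nat.cast_zero, zero_pow two_ne_zero, zero_mul, mul_eq_zero, pow_eq_zero_iff two_ne_zero,
      Nat.cast_eq_zero] at hh
    exact hh.elim (W.baseChange K).torsionOrder_pos_holds.ne'
      (fun h0 ↦ hPinf ((Affine.Point.canonicalHeight_eq_zero_iff_holds P).mp h0))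
  set q : ℚ := 4 * (I : ℚ) ^ 2 /
      ((Dt.c : ℚ) ^ 2 * (Units.torsionOrder K : ℚ) ^ 2 * ((W.tamagawaProduct : ℚ) ^ 2)) with hq_def
  have hcQ0 : (Dt.c : ℚ) ≠ 0 := by exact_mod_cast hc0
  have hcW0 : (W.tamagawaProduct : ℚ) ≠ 0 := by exact_mod_cast W.tamagawaProduct_pos_holds.ne'
  have hIQ0 : (I : ℚ) ≠ 0 := by exact_mod_cast hI0
  have hq' : q = ((I : ℚ) / ((Dt.c : ℚ) * (W.tamagawaProduct : ℚ))) ^ 2 := by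
    rw [hq_def, hw2]
    push_cast
    field_simp
    ring
  have hvc : padicValRat 2 (Dt.c : ℚ) = padicValInt 2 Dt.c := padicValRat.of_int
  have hval : padicValRat 2 q =
      2 * (padicValNat 2 I : ℤ) - 2 * (padicValInt 2 Dt.c : ℤ) - 2 * (padicValNat 2 W.tamagawaProduct : ℤ) := by
    rw [hq', padicValRat.pow, padicValRat.div hIQ0 (mul_ne_zero hcQ0 hcW0), padicValRat.mul hcQ0 hcW0, hvc, padicValRat.of_nat,
      padicValRat.of_nat]
    push_cast
    ring
  -- `ord₂ #Ш(W_K) = 2 ord₂ I − 2 ord₂ c − 2 ord₂ C(W)` from IDX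
  have hcard_pos : 0 < Nat.card (AddCommGroup.primaryComponent (W.baseChange K).sha 2) := Nat.card_pos
  have hshaV : (padicValNat 2 (W.baseChange K).shaOrder : ℤ) =
      2 * (padicValNat 2 I : ℤ) - 2 * (padicValInt 2 Dt.c : ℤ) - 2 * (padicValNat 2 W.tamagawaProduct : ℤ) := by
    rw [X11b.Three.Koly.padicValNat_shaOrder_eq (W.baseChange K) 2]
    have h := congrArg (padicValNat 2) hidx
    rw [padicValNat.mul hcard_pos.ne' (pow_ne_zero _ two_ne_zero), padicValNat.prime_pow, padicValNat.prime_pow] at h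
    omega
  exact ⟨⟨q, hshaC, by rw [hval, hshaV]⟩, hShaK, hPinf⟩

/-! ## §2 BSD₂ for every non-CM rank-one curve from the wall, Friedberg–Hoffstein, IDX and PRINT -/

/-- ★ **THE RANK-ONE TRANSFER: BSD₂ for EVERY non-CM globally minimal `W` with `r_an(W) = 1` ⟸ S1′ + FH + IDX + PRINT.**  Hypotheses: PRINT (`hGZ`,
`hGZK`, `hmod`, `hMilneC`, `hMP`) + Friedberg–Hoffstein `hFH`; `hS1` = S1′ (BSD₂ for every non-CM globally minimal curve of analytic rank `0` = WALL row 1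
of route ByReductionTypeAtTwo); `hIDX` = IDX: for `W` non-CM globally minimal with `r_an = 1`, at EVERY imaginary quadratic `K` with `d_K < −4`, Heegner
for `N_W`, `2` split, `L(W^{(d_K)},1) ≠ 0, EVERY datum `Dt`, Heegner datum `H`, embedding `ι` and `P ∈ W(K)` over the complex Heegner point:
`#Ш(W_K)[2^∞] · 2^{2(ord₂ c + ord₂ C(W))} = 2^{2 ord₂ [W(K) : ℤP]}`.  NO Selmer / torsion / sign / image / Tamagawa hypothesis on `W`.  Proof: datum
(BCDT) + parity ⟹ `w(W) = −1`; FH ⟹ `K` (Heegner, `2` split, `|d_K| > 4`, `L(W^{(d_K)},1) ≠ 0`); Néron minimal model of the twist is non-CM of analytic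
rank `0`, `BSD₂` by S1′; conductor-`1` datum over `K` and its Heegner point `P ∈ W(K)` (tree: Gross §4 + Shimura reciprocity); IDX; §1; Milne any model.
CONDITIONAL; proves nothing about BSD; closes nothing.  [cite: FriedbergHoffstein1995, main theorem] [cite: BurungaleSkinnerTianWan2024, proof of Thm. 12.3]
[cite: GrossZagier1986, V.§2 (2.2)] [cite: Milne1972ArithmeticAV, §1 Thm. 1] [cite: SilvermanAEC2009, VIII.8 Cor. 8.3] [cite: BCDTJAMS2001, Thm. A] -/
theorem bsdp_rankOne_of_wall_of_friedbergHoffstein_of_idx_of_facts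
    (hGZ : ∀ (N : ℕ) [NeZero N] (W : WeierstrassCurve ℚ) (K : Type) [Field K] [NumberField K], gross_zagier N W K)
    (hGZK : rank_eq_analyticRank_of_analyticRank_le_one) (hmod : hasEntireLFunction_rat)
    (hMilneC : Milne1972.bsdQuotient_baseChange_quadratic_anyModel) (hMP : nonempty_modularParametrizationData)
    (hFH : friedbergHoffstein_exists_heegnerField_split_twist_ne_zero)
    (hS1 : ∀ (W : WeierstrassCurve ℚ) [W.IsElliptic] [W.IsGloballyMinimal], ¬ W.HasCM → W.analyticRank = 0 → BSDp W 2)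
    (hIDX : ∀ (W : WeierstrassCurve ℚ) [W.IsElliptic] [W.IsGloballyMinimal] [NeZero (W.conductorNorm ℤ)],
      ¬ W.HasCM → W.analyticRank = 1 →
      ∀ (K : Type) [Field K] [NumberField K], IsImaginaryQuadratic K → NumberField.discr K < -4 →
        SatisfiesHeegnerHypothesis (W.conductorNorm ℤ) K → SatisfiesHeegnerHypothesis 2 K →
        (W.quadraticTwist (NumberField.discr K : ℚ)).entireLFunction 1 ≠ 0 →
        ∀ (Dt : ModularParametrizationData W (W.conductorNorm ℤ)) (H : HeegnerDatum (W.conductorNorm ℤ) (NumberField.discr K))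
          (ι : K →+* ℂ) (P : (W.baseChange K).toAffine.Point),
          WeierstrassCurve.Affine.Point.map ι.toRatAlgHom P = heegnerPointComplex Dt H →
          Nat.card (AddCommGroup.primaryComponent (W.baseChange K).sha 2) *
              2 ^ (2 * (padicValInt 2 Dt.c + padicValNat 2 W.tamagawaProduct)) =
            2 ^ (2 * padicValNat 2 (AddSubgroup.zmultiples P).index)) :
    ∀ (W : WeierstrassCurve ℚ) [W.IsElliptic] [W.IsGloballyMinimal], ¬ W.HasCM → W.analyticRank = 1 → BSDp W 2 := by
  intro W _ _ hcm hr
  haveI : NeZero (W.conductorNorm ℤ) := ⟨(W.conductorNorm_pos_holds).ne'⟩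
  -- the sign of the functional equation: `w(W) = −1` from `r_an(W) = 1`
  obtain ⟨Dt₀⟩ := hMP W
  have hw : W.rootNumber = -1 := by
    rcases Literature.NumberTheory.EllipticCurves.rootNumber_eq_one_or_eq_neg_one W with h1 | h1
    · exfalso
      have hev : Even W.analyticRank :=
        (Literature.Barriers.BirchSwinnertonDyer.even_analyticRank_iff_of_isNewformOf_conductorLevel Dt₀.isNewformOf).mpr h1
      rw [hr] at hev
      exact Nat.not_even_one hev
    · exact h1
  -- Friedberg–Hoffstein: an imaginary quadratic Heegner field with `2` split, `|d_K| > 4` and `L(W^{(d_K)},1) ≠ 0`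
  obtain ⟨K, _, _, hK, hB, hH, h2H, hL⟩ := hFH W hw 2 Nat.prime_two 4
  have h2 : Module.finrank ℚ K = 2 := hK.1
  have hlt : NumberField.discr K < -4 := by
    have hneg := hK.discr_neg
    omega
  -- a globally minimal model of the twist: non-CM of analytic rank 0, `BSD₂` by the wall
  have hD0 : (NumberField.discr K : ℚ) ≠ 0 := by exact_mod_cast NumberField.discr_ne_zero K
  haveI := W.isElliptic_quadraticTwist hD0
  obtain ⟨Cd, hmin⟩ := hasGlobalMinimalModel_rat_holds (W.quadraticTwist (NumberField.discr K : ℚ))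
  haveI := hmin
  have hcmd : ¬ (Cd • W.quadraticTwist (NumberField.discr K : ℚ)).HasCM := by
    rw [hasCM_iff_of_j_eq (((W.quadraticTwist (NumberField.discr K : ℚ)).variableChange_j Cd).trans (W.j_quadraticTwist hD0))]
    exact hcm
  have hrd : (Cd • W.quadraticTwist (NumberField.discr K : ℚ)).analyticRank = 0 := by
    rw [analyticRank_smul]
    exact ((W.quadraticTwist (NumberField.discr K : ℚ)).analyticRank_eq_zero_iff_holds (hmod _)).mpr hL
  have hBd : BSDp (Cd • W.quadraticTwist (NumberField.discr K : ℚ)) 2 := hS1 _ hcmd hrd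
  -- a conductor-1 datum over `K` and its Heegner point `P ∈ W(K)`
  obtain ⟨Dt, β, ι, d₁, -⟩ := exists_kolyvaginHeegnerData_one_of_nonempty_modularParametrizationData hMP W K hK hH
  obtain ⟨P, H, hP, -⟩ := exists_heegnerPoint_map_eq_derivedPoint_one hK hH d₁
  -- IDX and §1
  have hidx := hIDX W hcm hr K hK hlt hH h2H hL Dt H ι P hP
  obtain ⟨hKin, -, -⟩ := missingPPartOverCAt_baseChange_of_idx W K (hGZ _ W K) hGZK hmod hr hK hlt hH hL Dt H ι P hP hidx
  -- Milne any model: `BSD₂(Wd) + MissingPPartOverCAt (W ⊗ K) 2 ⟹ BSD₂(W)`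
  exact bsdp_of_pPartOverC_baseChange W 2 K (Cd • W.quadraticTwist (NumberField.discr K : ℚ)) hGZK hmod hMilneC (le_of_eq hr) h2 ⟨Cd, rfl⟩
    (by rw [hrd]; exact zero_le_one) hKin hBd

/-! ## §3 Losslessness: BSD₂ for non-CM `r_an ≤ 1` curves + PRINT ⟹ IDX -/

/-- ★ **IDX IS LOSSLESS: BSD₂ for non-CM curves of analytic rank ≤ 1 (= S1′ ∧ the rank-one statement) + PRINT ⟹ IDX** (text VERBATIM; FH not needed).
On a frame of IDX the Néron minimal model `Wd` of the twist is non-CM of analytic rank `0`, so `BSD₂(Wd)`; `BSD₂(W)`; Milne any model turns the pair into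
`MissingPPartOverCAt (W ⊗ K) 2` (`AdditivePotMult.missingPPartOverCAt_baseChange_iff_bsdp`), i.e. `ord₂ #Ш_an(W_K) = ord₂ #Ш(W_K)`, while Gross–Zagier over
`K` gives `ord₂ #Ш_an(W_K) = 2 ord₂ I − 2 ord₂ c − 2 ord₂ C(W)`.  CONDITIONAL; proves nothing about BSD; closes nothing.
[cite: GrossZagier1986, V.§2 (2.2)] [cite: Milne1972ArithmeticAV, §1 Thm. 1] [cite: Miller2011LMS, Def. 1.1] -/
theorem idx_of_bsdp_rankLeOne_of_facts
    (hGZ : ∀ (N : ℕ) [NeZero N] (W : WeierstrassCurve ℚ) (K : Type) [Field K] [NumberField K], gross_zagier N W K)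
    (hGZK : rank_eq_analyticRank_of_analyticRank_le_one) (hmod : hasEntireLFunction_rat)
    (hMilneC : Milne1972.bsdQuotient_baseChange_quadratic_anyModel)
    (hS1 : ∀ (W : WeierstrassCurve ℚ) [W.IsElliptic] [W.IsGloballyMinimal], ¬ W.HasCM → W.analyticRank = 0 → BSDp W 2)
    (hR1 : ∀ (W : WeierstrassCurve ℚ) [W.IsElliptic] [W.IsGloballyMinimal], ¬ W.HasCM → W.analyticRank = 1 → BSDp W 2) :
    ∀ (W : WeierstrassCurve ℚ) [W.IsElliptic] [W.IsGloballyMinimal] [NeZero (W.conductorNorm ℤ)],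
      ¬ W.HasCM → W.analyticRank = 1 →
      ∀ (K : Type) [Field K] [NumberField K], IsImaginaryQuadratic K → NumberField.discr K < -4 →
        SatisfiesHeegnerHypothesis (W.conductorNorm ℤ) K → SatisfiesHeegnerHypothesis 2 K →
        (W.quadraticTwist (NumberField.discr K : ℚ)).entireLFunction 1 ≠ 0 →
        ∀ (Dt : ModularParametrizationData W (W.conductorNorm ℤ)) (H : HeegnerDatum (W.conductorNorm ℤ) (NumberField.discr K))
          (ι : K →+* ℂ) (P : (W.baseChange K).toAffine.Point),
          WeierstrassCurve.Affine.Point.map ι.toRatAlgHom P = heegnerPointComplex Dt H →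
          Nat.card (AddCommGroup.primaryComponent (W.baseChange K).sha 2) *
              2 ^ (2 * (padicValInt 2 Dt.c + padicValNat 2 W.tamagawaProduct)) =
            2 ^ (2 * padicValNat 2 (AddSubgroup.zmultiples P).index) := by
  intro W _ _ _ hcm hr K _ _ hK hlt hH _h2H hL Dt H ι P hP
  haveI : Fact (Nat.Prime 2) := ⟨Nat.prime_two⟩
  haveI hEK : (W.baseChange K).IsElliptic := isElliptic_baseChange' W K
  have h2 : Module.finrank ℚ K = 2 := hK.1
  have hD0 : (NumberField.discr K : ℚ) ≠ 0 := by exact_mod_cast NumberField.discr_ne_zero K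
  haveI hEt : (W.quadraticTwist (NumberField.discr K : ℚ)).IsElliptic := W.isElliptic_quadraticTwist hD0
  -- the Néron minimal model of the twist: non-CM of analytic rank 0, `BSD₂` by the wall; `BSD₂(W)` by the rank-one statement
  obtain ⟨Cd, hmin⟩ := hasGlobalMinimalModel_rat_holds (W.quadraticTwist (NumberField.discr K : ℚ))
  haveI := hmin
  have hcmd : ¬ (Cd • W.quadraticTwist (NumberField.discr K : ℚ)).HasCM := by
    rw [hasCM_iff_of_j_eq (((W.quadraticTwist (NumberField.discr K : ℚ)).variableChange_j Cd).trans (W.j_quadraticTwist hD0))]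
    exact hcm
  have hrt : (W.quadraticTwist (NumberField.discr K : ℚ)).analyticRank = 0 :=
    ((W.quadraticTwist (NumberField.discr K : ℚ)).analyticRank_eq_zero_iff_holds (hmod _)).mpr hL
  have hrd : (Cd • W.quadraticTwist (NumberField.discr K : ℚ)).analyticRank = 0 := by rw [analyticRank_smul, hrt]
  have hBd : BSDp (Cd • W.quadraticTwist (NumberField.discr K : ℚ)) 2 := hS1 _ hcmd hrd
  have hBW : BSDp W 2 := hR1 W hcm hr
  -- Gross–Zagier over `K`, exact form
  have hw2 : Units.torsionOrder K = 2 :=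
    Literature.NumberTheory.QuadraticFields.Quadratic.torsionOrder_eq_two_of_discr_lt_neg_four h2 hlt
  have hc0 : Dt.c ≠ 0 := fun h ↦ Dt.cast_c_ne_zero (by rw [h, Int.cast_zero])
  have hrK : (W.baseChange K).analyticRank = 1 :=
    (P2.analyticRank_baseChange_eq_one_iff W K hmod h2).mpr (Or.inl ⟨hr, hrt⟩)
  obtain ⟨hrkK, hShaK, hPinf, hshaC⟩ := shaAnOverC_baseChange_eq_of_heegner W K Dt H ι P (hGZ _ W K) hGZK hmod hK hH hP hc0 hrK
  haveI hfinK : Finite (W.baseChange K).sha := hShaK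
  set I := (AddSubgroup.zmultiples P).index with hI_def
  have hI0 : I ≠ 0 := fun hI ↦ by
    have hh := P2.torsionOrder_sq_mul_canonicalHeight_eq_index_sq_mul_regulator (W.baseChange K) hrkK P hPinf
    rw [← hI_def, hI, Nat.cast_zero, zero_pow two_ne_zero, zero_mul, mul_eq_zero, pow_eq_zero_iff two_ne_zero,
      Nat.cast_eq_zero] at hh
    exact hh.elim (W.baseChange K).torsionOrder_pos_holds.ne'
      (fun h0 ↦ hPinf ((Affine.Point.canonicalHeight_eq_zero_iff_holds P).mp h0))
  set q : ℚ := 4 * (I : ℚ) ^ 2 /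
      ((Dt.c : ℚ) ^ 2 * (Units.torsionOrder K : ℚ) ^ 2 * ((W.tamagawaProduct : ℚ) ^ 2)) with hq_def
  have hcQ0 : (Dt.c : ℚ) ≠ 0 := by exact_mod_cast hc0
  have hcW0 : (W.tamagawaProduct : ℚ) ≠ 0 := by exact_mod_cast W.tamagawaProduct_pos_holds.ne'
  have hIQ0 : (I : ℚ) ≠ 0 := by exact_mod_cast hI0
  have hq' : q = ((I : ℚ) / ((Dt.c : ℚ) * (W.tamagawaProduct : ℚ))) ^ 2 := by
    rw [hq_def, hw2]
    push_cast
    field_simp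
    ring
  have hvc : padicValRat 2 (Dt.c : ℚ) = padicValInt 2 Dt.c := padicValRat.of_int
  have hval : padicValRat 2 q =
      2 * (padicValNat 2 I : ℤ) - 2 * (padicValInt 2 Dt.c : ℤ) - 2 * (padicValNat 2 W.tamagawaProduct : ℤ) := by
    rw [hq', padicValRat.pow, padicValRat.div hIQ0 (mul_ne_zero hcQ0 hcW0), padicValRat.mul hcQ0 hcW0, hvc, padicValRat.of_nat,
      padicValRat.of_nat]
    push_cast
    ring
  -- the BSD pair gives `ord₂ #Ш_an(W_K) = ord₂ #Ш(W_K)`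
  obtain ⟨q', hq'', hv'⟩ :=
    (missingPPartOverCAt_baseChange_iff_bsdp W 2 K (Cd • W.quadraticTwist (NumberField.discr K : ℚ)) hGZK hmod hMilneC (by rw [hr]) h2
      ⟨Cd, rfl⟩ (by rw [hrd]; exact zero_le_one) hBd).mpr hBW
  have hqq : q' = q := Rat.cast_injective (α := ℂ) (hq''.symm.trans hshaC)
  rw [hqq, hval, X11b.Three.Koly.padicValNat_shaOrder_eq (W.baseChange K) 2] at hv'
  -- `#Ш(W_K)[2^∞] = 2^k` with `k = 2 ord₂ I − 2 ord₂ c − 2 ord₂ C(W)`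
  obtain ⟨k, hk⟩ := X11b.SelmerCount.exists_natCard_primaryComponent_eq_pow_of_finite 2 (G := (W.baseChange K).sha)
  rw [hk, padicValNat.prime_pow] at hv'
  have hk' : (k : ℤ) = 2 * (padicValNat 2 I : ℤ) - 2 * (padicValInt 2 Dt.c : ℤ) - 2 * (padicValNat 2 W.tamagawaProduct : ℤ) := by
    exact_mod_cast hv'.symm
  have hkeq : k + 2 * (padicValInt 2 Dt.c + padicValNat 2 W.tamagawaProduct) = 2 * padicValNat 2 I := by omega
  rw [hk, ← pow_add, hkeq]

/-! ## §4 The K4 leaf, modulo PRINT + FH: `NonCMAtTwo ⟺ rank-zero wall ∧ IDX` -/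

/-- ★ **THE LEAF IN ONE LINE: modulo PRINT + Friedberg–Hoffstein, `Rank1Residual.NonCMAtTwo ↔ S1′ ∧ IDX`.**  `NonCMAtTwo` (BSD₂ for every non-CM globally
minimal curve of analytic rank `≤ 1`) splits as its rank-zero half S1′ (= WALL row 1 of route ByReductionTypeAtTwo, stmt-19095–19098, by the reduction-type
tetrachotomy at `2`) and its rank-one half; by §2 and §3 the rank-one half is, modulo S1′ + PRINT + FH, EXACTLY the single ∀-statement IDX — the
`2`-primary Gross–Zagier index relation for non-CM rank-one curves over Friedberg–Hoffstein fields.  A CENSUS statement: nothing about BSD is proved, IDX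
is as open as the leaf's rank-one half.  [cite: GrossZagier1986, V.§2 (2.2)] [cite: FriedbergHoffstein1995, main theorem] [cite: Miller2011LMS, Def. 1.1] -/
theorem nonCMAtTwo_iff_rankZero_and_idx_of_facts
    (hGZ : ∀ (N : ℕ) [NeZero N] (W : WeierstrassCurve ℚ) (K : Type) [Field K] [NumberField K], gross_zagier N W K)
    (hGZK : rank_eq_analyticRank_of_analyticRank_le_one) (hmod : hasEntireLFunction_rat)
    (hMilneC : Milne1972.bsdQuotient_baseChange_quadratic_anyModel) (hMP : nonempty_modularParametrizationData)
    (hFH : friedbergHoffstein_exists_heegnerField_split_twist_ne_zero) :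
    Summit.BirchSwinnertonDyer.BirchSwinnertonDyer.Rank1Residual.NonCMAtTwo ↔
      ((∀ (W : WeierstrassCurve ℚ) [W.IsElliptic] [W.IsGloballyMinimal], ¬ W.HasCM → W.analyticRank = 0 → BSDp W 2) ∧
      ∀ (W : WeierstrassCurve ℚ) [W.IsElliptic] [W.IsGloballyMinimal] [NeZero (W.conductorNorm ℤ)],
      ¬ W.HasCM → W.analyticRank = 1 →
      ∀ (K : Type) [Field K] [NumberField K], IsImaginaryQuadratic K → NumberField.discr K < -4 →
        SatisfiesHeegnerHypothesis (W.conductorNorm ℤ) K → SatisfiesHeegnerHypothesis 2 K →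
        (W.quadraticTwist (NumberField.discr K : ℚ)).entireLFunction 1 ≠ 0 →
        ∀ (Dt : ModularParametrizationData W (W.conductorNorm ℤ)) (H : HeegnerDatum (W.conductorNorm ℤ) (NumberField.discr K))
          (ι : K →+* ℂ) (P : (W.baseChange K).toAffine.Point),
          WeierstrassCurve.Affine.Point.map ι.toRatAlgHom P = heegnerPointComplex Dt H →
          Nat.card (AddCommGroup.primaryComponent (W.baseChange K).sha 2) *
              2 ^ (2 * (padicValInt 2 Dt.c + padicValNat 2 W.tamagawaProduct)) =
            2 ^ (2 * padicValNat 2 (AddSubgroup.zmultiples P).index)) := by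
  refine ⟨fun h ↦ ?_, fun ⟨hS1, hIDX⟩ W _ _ hcm hr ↦ ?_⟩
  · have hS1 : ∀ (W : WeierstrassCurve ℚ) [W.IsElliptic] [W.IsGloballyMinimal], ¬ W.HasCM → W.analyticRank = 0 → BSDp W 2 :=
      fun W _ _ hcm hr0 ↦ h W hcm (by rw [hr0]; exact zero_le_one)
    exact ⟨hS1, idx_of_bsdp_rankLeOne_of_facts hGZ hGZK hmod hMilneC hS1 fun W _ _ hcm hr1 ↦ h W hcm (le_of_eq hr1)⟩
  · rcases Nat.le_one_iff_eq_zero_or_eq_one.mp hr with hr0 | hr1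
    · exact hS1 W hcm hr0
    · exact bsdp_rankOne_of_wall_of_friedbergHoffstein_of_idx_of_facts hGZ hGZK hmod hMilneC hMP hFH hS1 hIDX W hcm hr1

end Summit.BirchSwinnertonDyer.BirchSwinnertonDyer.Theorems.GenusExact.TwinSwap.RankOneTransfer

end
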